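import Mathlib
import HarnessLib
import Summits.ResolutionOfSingularities.ResolutionOfSingularities.Theorems.HomologicalConductorPersistenceKC3WitnessTransport
import Summits.ResolutionOfSingularities.ResolutionOfSingularities.Theorems.HomologicalConductorPersistenceKC3FrobeniusOrderDefs

/-!
# Crux `Persistence` (stmt-ResolutionOfSingularities-16484), chain W4.4b — K-C3 K4c (socket form):
# `a⁶` does not stably annihilate `Λ' ⊗_{W₀} X_b` for every localisation `Λ'` of `W₀` at unit-constant denominators

Route `ResolutionOfSingularities/HomologicalConductor`.  OURS (cell res-hironaka, crux chain W4.4b,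
K-C3-REPRO.md 40352614fdfe8abf §3/§7; CHAIN v13.5 §V13.13 «K4c / K4e → 058», K5 socket of
res-D-pv-037 `not_mem_cohomologyAnnihilator(OfDegree)_of_kc3Lattice_isLocalization … (hx : ¬
StablyAnnihilates Λ' x (Λ' ⊗[W₀] L))`; seat res-D-pv-058); nothing here is a statement of the
manuscript under review (Hironaka 2017); AI-written, weaker than expert review.

`W₀ = kc3W k = k[a⁶, a⁴b, a³c, a²b², abc, c², b³] ⊆ k[a,b,c]` is res-D-pv-037's model of the K-C3 chart
ring (`…KC3FrobeniusOrderDefs`).  This file supplies the `hx` of the K5 socket DIRECTLY in that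
interface, with no valuation ring and no dictionary:

* §1 (generic) `stablyAnnihilates_baseChange_coker_iff` — for a matrix `D : Λᵐˣⁿ` and any
  `Λ`-algebra `Λ'`: `y` stably annihilates `Λ' ⊗_Λ coker D` iff the sandwich `D' B D' = y • D'` is
  solvable over `Λ'` (`D' = D.map (algebraMap Λ Λ')`; right exactness of `Λ' ⊗ −`, the presentation
  criterion (P) of `PersistenceFaithfullyFlatDescent`, `LinearMap.toMatrix_baseChange`).
* §2 `kc3DW` — the witness matrix `kc3D` (K-C3-REPRO §3) with entries in `W₀`; **`kc3Xb k :=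
  (Fin 8 → W₀) ⧸ range kc3DW`** = the module `X_b` of record (037's INTERFACE 13:00:26Z: a quotient of
  `Fin 8 → ↥(kc3W k)`, so that its `↥(kc3P k)`-module structure is the canonical one); `kc3x = a⁶ ∈ W₀`.
* §3 **`not_stablyAnnihilates_baseChange`** — for every commutative `W₀`-algebra `Λ'` that is a
  localisation `IsLocalization S Λ'` at a submonoid `S` of elements with NON-ZERO CONSTANT TERM:
  `¬ StablyAnnihilates Λ' (algebraMap W₀ Λ' a⁶) (Λ' ⊗_{W₀} X_b)`.  Proof: §1 gives a sandwich over
  `Λ'`; `KC3WitnessTransport.not_stablyAnnihilates_coker_of_transport` with `Φ = IsLocalization.lift`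
  of `W₀ ↪ k[a,b,c] ↪ k(a,b,c)` (denominators in `S` are non-zero), denominators `w/s`, `s ∈ S`, from
  `IsLocalization.mk'_surjective`, contradicts K4a/b.  The consumer takes `Λ' = T₁` (= `loc O W`, a
  localisation of `W ≅ W₀` at the elements with unit constant term, K2c/K3b) and `S` that submonoid.
[OURS; elementary.]
-/

noncomputable section

-- single-problem summit: the doubled namespace component `ResolutionOfSingularities` is forced
set_option linter.dupNamespace false

open CategoryTheory MvPolynomial
open scoped TensorProduct
open Summit.ResolutionOfSingularities.ResolutionOfSingularities.Theorems.NoZeno.SandwichCluster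
open Summit.ResolutionOfSingularities.ResolutionOfSingularities.Theorems.HomologicalConductor.PersistenceFaithfullyFlatDescent
open Summit.ResolutionOfSingularities.ResolutionOfSingularities.Theorems.HomologicalConductor.KC3Witness
open Summit.ResolutionOfSingularities.ResolutionOfSingularities.Theorems.HomologicalConductor.KC3WitnessTransport
open Summit.ResolutionOfSingularities.ResolutionOfSingularities.Theorems.HomologicalConductor.KC3FrobeniusOrder

universe u

namespace Summit.ResolutionOfSingularities.ResolutionOfSingularities.Theorems.HomologicalConductor.KC3WitnessBaseChange

/-! ## §1 Stable annihilation of a base-changed cokernel = a sandwich over the new ring -/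

section Generic

variable {Λ : Type u} [CommRing Λ] (Λ' : Type u) [CommRing Λ'] [Algebra Λ Λ'] {m n : ℕ}

/-- **Base change of the sandwich criterion.**  For `D : Matrix (Fin m) (Fin n) Λ`, a `Λ`-algebra `Λ'`
and `y ∈ Λ'`: `y` stably annihilates `Λ' ⊗_Λ (Λᵐ ⧸ D Λⁿ)` iff `∃ B, D' B D' = y • D'` over `Λ'`,
`D' = D.map (algebraMap Λ Λ')` (the base-changed presentation `Λ' ⊗ Λⁿ → Λ' ⊗ Λᵐ → Λ' ⊗ coker D → 0`
stays exact; criterion (P) + the sandwich equation; matrices in the bases `1 ⊗ eᵢ`). [folklore] -/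
theorem stablyAnnihilates_baseChange_coker_iff (D : Matrix (Fin m) (Fin n) Λ) (y : Λ') :
    StablyAnnihilates Λ' y
        (ModuleCat.of Λ' (Λ' ⊗[Λ] ((Fin m → Λ) ⧸ LinearMap.range D.mulVecLin))) ↔
      ∃ B : Matrix (Fin n) (Fin m) Λ',
        D.map (algebraMap Λ Λ') * B * D.map (algebraMap Λ Λ') = y • D.map (algebraMap Λ Λ') := by
  have hex : Function.Exact D.mulVecLin (LinearMap.range D.mulVecLin).mkQ :=
    LinearMap.exact_iff.mpr (Submodule.ker_mkQ _)
  have hπ : Function.Surjective (LinearMap.range D.mulVecLin).mkQ := Submodule.mkQ_surjective _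
  have hexS : Function.Exact (D.mulVecLin.baseChange Λ') ((LinearMap.range D.mulVecLin).mkQ.baseChange Λ') := by
    rw [LinearMap.baseChange_eq_ltensor, LinearMap.baseChange_eq_ltensor]
    exact lTensor_exact Λ' hex hπ
  have hπS : Function.Surjective ((LinearMap.range D.mulVecLin).mkQ.baseChange Λ') := by
    rw [LinearMap.baseChange_eq_ltensor]
    exact LinearMap.lTensor_surjective Λ' hπ
  rw [stablyAnnihilates_iff_exists_comp_eq_smul_id y _ hπS,
    exists_comp_eq_smul_id_iff_exists_sandwich y _ _ hexS hπS]
  have hρ : LinearMap.toMatrix (Algebra.TensorProduct.basis Λ' (Pi.basisFun Λ (Fin n)))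
      (Algebra.TensorProduct.basis Λ' (Pi.basisFun Λ (Fin m))) (D.mulVecLin.baseChange Λ') =
      D.map (algebraMap Λ Λ') := by
    rw [LinearMap.toMatrix_baseChange]
    congr 1
    ext i j
    simp [LinearMap.toMatrix_apply]
  -- `toMatrix` is additive and `Λ'`-linear (instances recorded explicitly: generic `map_neg`/`map_smul`
  -- do not fire by `rw`/`simp` on these tensor-product function spaces)
  have hneg := fun f : Λ' ⊗[Λ] (Fin n → Λ) →ₗ[Λ'] Λ' ⊗[Λ] (Fin m → Λ) =>
    map_neg (LinearMap.toMatrix (Algebra.TensorProduct.basis Λ' (Pi.basisFun Λ (Fin n)))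
      (Algebra.TensorProduct.basis Λ' (Pi.basisFun Λ (Fin m)))) f
  have hsmul := fun f : Λ' ⊗[Λ] (Fin n → Λ) →ₗ[Λ'] Λ' ⊗[Λ] (Fin m → Λ) =>
    map_smul (LinearMap.toMatrix (Algebra.TensorProduct.basis Λ' (Pi.basisFun Λ (Fin n)))
      (Algebra.TensorProduct.basis Λ' (Pi.basisFun Λ (Fin m)))) y f
  have hneg' := fun f : Λ' ⊗[Λ] (Fin m → Λ) →ₗ[Λ'] Λ' ⊗[Λ] (Fin n → Λ) =>
    map_neg (LinearMap.toMatrix (Algebra.TensorProduct.basis Λ' (Pi.basisFun Λ (Fin m)))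
      (Algebra.TensorProduct.basis Λ' (Pi.basisFun Λ (Fin n)))) f
  constructor
  · rintro ⟨β, hβ⟩
    refine ⟨-LinearMap.toMatrix (Algebra.TensorProduct.basis Λ' (Pi.basisFun Λ (Fin m)))
      (Algebra.TensorProduct.basis Λ' (Pi.basisFun Λ (Fin n))) β, ?_⟩
    have h := congrArg (LinearMap.toMatrix (Algebra.TensorProduct.basis Λ' (Pi.basisFun Λ (Fin n)))
      (Algebra.TensorProduct.basis Λ' (Pi.basisFun Λ (Fin m)))) hβ
    rw [LinearMap.toMatrix_comp _ (Algebra.TensorProduct.basis Λ' (Pi.basisFun Λ (Fin n))) _,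
      LinearMap.toMatrix_comp _ (Algebra.TensorProduct.basis Λ' (Pi.basisFun Λ (Fin m))) _, hneg, hsmul,
      hρ] at h
    rw [Matrix.mul_neg, Matrix.neg_mul, Matrix.mul_assoc, h, neg_neg]
  · rintro ⟨B, hB⟩
    refine ⟨-Matrix.toLin (Algebra.TensorProduct.basis Λ' (Pi.basisFun Λ (Fin m)))
      (Algebra.TensorProduct.basis Λ' (Pi.basisFun Λ (Fin n))) B, ?_⟩
    apply (LinearMap.toMatrix (Algebra.TensorProduct.basis Λ' (Pi.basisFun Λ (Fin n)))
      (Algebra.TensorProduct.basis Λ' (Pi.basisFun Λ (Fin m)))).injective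
    rw [LinearMap.toMatrix_comp _ (Algebra.TensorProduct.basis Λ' (Pi.basisFun Λ (Fin n))) _,
      LinearMap.toMatrix_comp _ (Algebra.TensorProduct.basis Λ' (Pi.basisFun Λ (Fin m))) _, hneg, hsmul,
      hneg', hρ, LinearMap.toMatrix_toLin, Matrix.neg_mul, Matrix.mul_neg, ← Matrix.mul_assoc, hB]

end Generic

/-! ## §2 The witness over `W₀ = kc3W k`: the matrix `kc3DW`, the module `X_b`, the element `a⁶` -/

section KC3

variable (k : Type u) [Field k]

/-- A monomial `c · a^p b^q c^r` with `6 ∣ p + 2q + 3r` lies in `W₀`. [OURS] -/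
theorem monomial_e_mem_kc3W (p q r : ℕ) (c : k) (h : 6 ∣ p + 2 * q + 3 * r) :
    monomial (e p q r) c ∈ kc3W k :=
  monomial_mem_kc3W (by simpa [wt] using h) c

/-- Every entry of the witness matrix `kc3D` lies in `W₀`. [OURS · K-C3-REPRO §3] -/
theorem kc3D_mem (i : Fin 8) (j : Fin 12) : kc3D k i j ∈ kc3W k := by
  fin_cases i <;> fin_cases j <;>
    first
      | exact zero_mem _
      | exact monomial_e_mem_kc3W k _ _ _ _ (by norm_num)

/-- **The witness matrix over `W₀`**: `kc3D` with entries read in `W₀ = kc3W k`. [OURS · K-C3-REPRO §3] -/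
def kc3DW : Matrix (Fin 8) (Fin 12) ↥(kc3W k) := Matrix.of fun i j => ⟨kc3D k i j, kc3D_mem k i j⟩

variable {k} in
/-- The entries of `kc3DW` are those of `kc3D`. [OURS] -/
@[simp] theorem coe_kc3DW (i : Fin 8) (j : Fin 12) :
    ((kc3DW k i j : ↥(kc3W k)) : MvPolynomial (Fin 3) k) = kc3D k i j := rfl

/-- `kc3DW` maps to `kc3D` under `W₀ ↪ k[a,b,c]`. [OURS] -/
theorem kc3DW_map_val : (kc3DW k).map (fun w : ↥(kc3W k) => (w : MvPolynomial (Fin 3) k)) = kc3D k :=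
  Matrix.ext fun _ _ => rfl

/-- Instance shortcut: `P₀` acts on `W₀⁸` (through `kc3W.algebraP`; instance search through the
subalgebra types is slow, so the `W₀⁸`- and `X_b`-instances below are recorded once). [folklore] -/
instance instSMulPiW : SMul ↥(kc3P k) (Fin 8 → ↥(kc3W k)) := Pi.instSMul

set_option synthInstance.maxHeartbeats 400000 in
/-- Instance shortcut: the `P₀`-module `W₀⁸`. [folklore] -/
instance instModulePiW : Module ↥(kc3P k) (Fin 8 → ↥(kc3W k)) := Pi.module _ _ _

set_option synthInstance.maxHeartbeats 400000 in
/-- Instance shortcut: the tower `P₀ → W₀ → W₀⁸`. [folklore] -/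
instance instIsScalarTowerPiW : IsScalarTower ↥(kc3P k) ↥(kc3W k) (Fin 8 → ↥(kc3W k)) :=
  Pi.isScalarTower

/-- **The module `X_b` of record over `W₀`**: `X_b = W₀⁸ ⧸ kc3DW · W₀¹²` (K-C3-REPRO §3: generators
`g₀…g₇`, relations `r₀…r₁₁`).  A quotient of `Fin 8 → ↥(kc3W k)` (res-D-pv-037 INTERFACE), with its module
structures recorded as the explicit instances below (a `def`, not an `abbrev`: instance search on quotients
of modules over the subalgebra `↥(kc3W k)` does not terminate in the default budget). [OURS · K-C3-REPRO §3] -/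
def kc3Xb : Type u := (Fin 8 → ↥(kc3W k)) ⧸ LinearMap.range (kc3DW k).mulVecLin

set_option synthInstance.maxHeartbeats 400000 in
set_option maxHeartbeats 1000000 in
/-- `X_b` is an additive group (the quotient structure). [folklore] -/
instance kc3Xb.instAddCommGroup : AddCommGroup (kc3Xb k) :=
  Submodule.Quotient.addCommGroup (LinearMap.range (kc3DW k).mulVecLin)

set_option synthInstance.maxHeartbeats 400000 in
set_option maxHeartbeats 1000000 in
/-- The `W₀`-module structure of `X_b` (the quotient structure). [folklore] -/
instance kc3Xb.instModule : Module ↥(kc3W k) (kc3Xb k) :=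
  Submodule.Quotient.module (LinearMap.range (kc3DW k).mulVecLin)

set_option synthInstance.maxHeartbeats 400000 in
set_option maxHeartbeats 1000000 in
/-- The `P₀`-module structure of `X_b` (res-D-pv-037 INTERFACE: the canonical one, `Submodule.Quotient.module'`
through `kc3W.algebraP`). [folklore] -/
instance kc3Xb.instModuleP : Module ↥(kc3P k) (kc3Xb k) :=
  Submodule.Quotient.module' (LinearMap.range (kc3DW k).mulVecLin)

set_option synthInstance.maxHeartbeats 400000 in
set_option maxHeartbeats 1000000 in
/-- The tower `P₀ → W₀ → X_b`. [folklore] -/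
instance kc3Xb.instIsScalarTower : IsScalarTower ↥(kc3P k) ↥(kc3W k) (kc3Xb k) :=
  Submodule.Quotient.isScalarTower (S := ↥(kc3P k)) (LinearMap.range (kc3DW k).mulVecLin) ↥(kc3W k)

set_option synthInstance.maxHeartbeats 400000 in
set_option maxHeartbeats 1000000 in
/-- `X_b` is finitely generated over `W₀`. [folklore] -/
instance kc3Xb.instFinite : Module.Finite ↥(kc3W k) (kc3Xb k) :=
  Module.Finite.quotient ↥(kc3W k) (LinearMap.range (kc3DW k).mulVecLin)

/-- The quotient map `W₀⁸ → X_b`. [OURS] -/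
def kc3XbMk : (Fin 8 → ↥(kc3W k)) →ₗ[↥(kc3W k)] kc3Xb k := (LinearMap.range (kc3DW k).mulVecLin).mkQ

/-- `kc3Xb k` is, by definition, the cokernel `W₀⁸ ⧸ range ∂`. [OURS] -/
theorem kc3Xb_def : kc3Xb k = ((Fin 8 → ↥(kc3W k)) ⧸ LinearMap.range (kc3DW k).mulVecLin) := rfl

/-- The relation module is the span of the columns of `kc3DW`. [folklore] -/
theorem range_kc3DW_mulVecLin :
    LinearMap.range (kc3DW k).mulVecLin = Submodule.span ↥(kc3W k) (Set.range (kc3DW k).col) :=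
  Matrix.range_mulVecLin _

/-- **`x = a⁶ ∈ W₀`.** [OURS] -/
def kc3x : ↥(kc3W k) :=
  ⟨X 0 ^ 6, by rw [kc3W]; exact Algebra.subset_adjoin (Set.mem_insert _ _)⟩

/-- `kc3x` is `a⁶`. [OURS] -/
@[simp] theorem coe_kc3x : ((kc3x k : ↥(kc3W k)) : MvPolynomial (Fin 3) k) = X 0 ^ 6 := rfl

/-! ## §3 K4c, socket form -/

/-- **K-C3 K4c (socket form).**  Let `Λ'` be a commutative `W₀`-algebra which is the localisation of
`W₀ = kc3W k` at a submonoid `S` all of whose elements have NON-ZERO CONSTANT TERM (the consumer: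
`Λ' = T₁ = loc O W ≅ W₀[S⁻¹]`, `S` = the elements with unit constant term).  Then `a⁶` does NOT stably
annihilate `Λ' ⊗_{W₀} X_b` over `Λ'` — the hypothesis `hx` of res-D-pv-037's K5 socket
`not_mem_cohomologyAnnihilator(OfDegree)_of_kc3Lattice_isLocalization`.  (§1 turns a factorisation into
a sandwich `D' B D' = a⁶ • D'` over `Λ'`; `IsLocalization.lift` of `W₀ ↪ k(a,b,c)` transports it, every
element of `Λ'` being `w/s` with `s ∈ S`, `s(0) ≠ 0`; `KC3WitnessTransport.not_stablyAnnihilates_coker_of_transport`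
(K4a/b + clearing denominators) refutes it.) [OURS · K-C3-REPRO §7 K4c] -/
theorem not_stablyAnnihilates_baseChange (Λ' : Type u) [CommRing Λ'] [Algebra ↥(kc3W k) Λ']
    (S : Submonoid ↥(kc3W k)) [IsLocalization S Λ']
    (hS : ∀ s ∈ S, coeff 0 (s : MvPolynomial (Fin 3) k) ≠ 0) :
    ¬ StablyAnnihilates Λ' (algebraMap ↥(kc3W k) Λ' (kc3x k))
      (ModuleCat.of Λ' (Λ' ⊗[↥(kc3W k)] kc3Xb k)) := by
  intro h
  obtain ⟨B, hB⟩ := (stablyAnnihilates_baseChange_coker_iff Λ' (kc3DW k) _).mp h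
  -- the transport map `Φ : Λ' → k(a,b,c)`
  have hg : ∀ s : S, IsUnit (((algebraMap (MvPolynomial (Fin 3) k) (FractionRing (MvPolynomial (Fin 3) k))).comp
      (kc3W k).val.toRingHom) (s : ↥(kc3W k))) := by
    intro s
    rw [isUnit_iff_ne_zero]
    intro h0
    apply hS s s.2
    have : ((s : ↥(kc3W k)) : MvPolynomial (Fin 3) k) = 0 :=
      IsFractionRing.injective (MvPolynomial (Fin 3) k) (FractionRing (MvPolynomial (Fin 3) k))
        (h0.trans (map_zero _).symm)
    rw [this, coeff_zero]
  have hΦ : ∀ w : ↥(kc3W k), IsLocalization.lift (S := Λ') hg (algebraMap (↥(kc3W k)) Λ' w) =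
      algebraMap (MvPolynomial (Fin 3) k) (FractionRing (MvPolynomial (Fin 3) k)) (w : MvPolynomial (Fin 3) k) :=
    fun w => IsLocalization.lift_eq hg w
  refine not_stablyAnnihilates_coker_of_transport (k := k) (L := FractionRing (MvPolynomial (Fin 3) k))
    (IsLocalization.lift (S := Λ') hg) (IsFractionRing.injective _ _) ((kc3DW k).map (algebraMap _ Λ')) ?_
    (algebraMap _ Λ' (kc3x k)) ?_ ?_ ((stablyAnnihilates_coker_iff_exists_mul_mul_eq' _ _).mpr ⟨B, hB⟩)
  · rw [Matrix.map_map]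
    ext i j
    simp only [Matrix.map_apply, Function.comp_apply, hΦ, coe_kc3DW]
  · rw [hΦ, coe_kc3x]
  · intro e'
    obtain ⟨⟨a, s⟩, he⟩ := IsLocalization.mk'_surjective S e'
    refine ⟨(a : MvPolynomial (Fin 3) k), ((s : ↥(kc3W k)) : MvPolynomial (Fin 3) k), hS s s.2, ?_⟩
    rw [← he, ← hΦ a, ← hΦ (s : ↥(kc3W k)), ← map_mul, IsLocalization.mk'_spec]

end KC3

end Summit.ResolutionOfSingularities.ResolutionOfSingularities.Theorems.HomologicalConductor.KC3WitnessBaseChange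

end
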